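import Mathlib.Analysis.InnerProductSpace.PiL2
import Mathlib.Geometry.Manifold.IsManifold.Basic
import Mathlib.Geometry.Manifold.Instances.Real
import Literature.Topology.FourManifolds.SurfaceSmoothingAdaptedCharts
import HarnessLib

/-!
# The level curve of a planar atlas as a `1`-manifold (surface-smoothing programme, P3 part A)

Topic `Literature/Topology/FourManifolds` (the `n = 2` leaf of
`Literature.Topology.FourManifolds.exists_chartedSpace_isManifold_of_le_three`, spc4.S33, seat 1 /
approach B; sequel to `SurfaceSmoothingAdaptedCharts.lean`). **Definitions with bodies and proved
statements; no named fact.**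

Along the boundary `Z` of a smooth sublevel domain the programme has *adapted charts*
(`exists_adaptedChart`): pairwise `C^∞`-compatible planar charts covering `Z` in each of which
`Z` is the real axis. This file turns such a family into a `C^∞` structure of dimension `1` on
the subtype `Z`, so that the tree's classification of compact `1`-manifolds
(`OneManifold.isOrientable`, `nonempty_diffeomorph_sphere_one_of_smoothOrientation`, the flow
parametrisation of `OneManifoldOrbits.lean`) applies to its components:

* `AdaptedFamily X Z` — the data: charts, covering `Z`, pairwise `IsSmoothCompat`, and
  `x ∈ Z ↔ im (e x) = 0` on each source.
* `AdaptedFamily.reChart` — the real chart `z ↦ re (e z)` of the subtype `Z`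
  (`OpenPartialHomeomorph Z ℝ`), with source `Z ∩ e.source` and target `{r | ↑r ∈ e.target}`;
  `reChart_symm_apply_coe` computes its inverse.
* `AdaptedFamily.contDiffOn_reChart_trans` — the transition maps of two real charts are `C^∞`
  (they are `re ∘ (e' ∘ e.symm) ∘ ofReal`).
* `AdaptedFamily.chartedSpace`, `AdaptedFamily.isManifold` — the `ChartedSpace
  (EuclideanSpace ℝ (Fin 1)) Z` structure (real charts read through the linear isometry
  `ℝ ≃ ℝ¹`, as in `SPC4Wave0SmoothingDimOne.lean`) and `IsManifold (𝓡 1) ∞ Z`.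
-/

noncomputable section

open Set Function Complex
open scoped Manifold ContDiff Topology

namespace Literature.Topology.FourManifolds

namespace SurfaceSmoothing

variable {X : Type*} [TopologicalSpace X]

variable (X) in
/-- **Adapted charts along a subset `Z ⊆ X`**: planar charts covering `Z`, pairwise
`C^∞`-compatible, in each of which `Z` is exactly the real axis. [folklore] -/
structure AdaptedFamily (Z : Set X) where
  /-- The charts. -/
  charts : Set (OpenPartialHomeomorph X ℂ)
  /-- They cover `Z`. -/
  covers : ∀ z ∈ Z, ∃ e ∈ charts, z ∈ e.source
  /-- They are pairwise compatible. -/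
  compat : ∀ e ∈ charts, ∀ e' ∈ charts, IsSmoothCompat e e'
  /-- In each chart, `Z` is the real axis. -/
  mem_iff : ∀ e ∈ charts, ∀ x ∈ e.source, x ∈ Z ↔ (e x).im = 0

namespace AdaptedFamily

variable {Z : Set X} (𝒻 : AdaptedFamily X Z)

/-- A point of `Z` in an adapted chart has a real image: `e z = re (e z)`. [folklore] -/
theorem apply_eq_re {e : OpenPartialHomeomorph X ℂ} (he : e ∈ 𝒻.charts) {z : X} (hz : z ∈ Z)
    (hze : z ∈ e.source) : e z = ((e z).re : ℂ) := by
  apply Complex.ext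
  · simp
  · rw [(𝒻.mem_iff e he z hze).1 hz]; simp

/-- A real point of the target of an adapted chart comes from `Z`. [folklore] -/
theorem symm_mem {e : OpenPartialHomeomorph X ℂ} (he : e ∈ 𝒻.charts) {r : ℝ}
    (hr : (r : ℂ) ∈ e.target) : e.symm r ∈ Z :=
  (𝒻.mem_iff e he _ (e.map_target hr)).2 (by rw [e.right_inv hr]; simp)

variable [Nonempty Z]

open Classical in
/-- The inverse of the real chart: `r ↦ e.symm r` when `↑r ∈ e.target` (junk elsewhere).
[folklore] -/
def reInv {e : OpenPartialHomeomorph X ℂ} (he : e ∈ 𝒻.charts) (r : ℝ) : Z :=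
  if h : (r : ℂ) ∈ e.target then ⟨e.symm r, 𝒻.symm_mem he h⟩ else Classical.arbitrary Z

/-- The inverse of the real chart on the target. [folklore] -/
theorem reInv_of_mem {e : OpenPartialHomeomorph X ℂ} (he : e ∈ 𝒻.charts) {r : ℝ}
    (hr : (r : ℂ) ∈ e.target) : 𝒻.reInv he r = ⟨e.symm r, 𝒻.symm_mem he hr⟩ := by
  unfold reInv
  rw [dif_pos hr]

/-- The inverse of the real chart on the target, as a point of `X`. [folklore] -/
theorem reInv_coe_of_mem {e : OpenPartialHomeomorph X ℂ} (he : e ∈ 𝒻.charts) {r : ℝ}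
    (hr : (r : ℂ) ∈ e.target) : (𝒻.reInv he r : X) = e.symm r := by
  rw [𝒻.reInv_of_mem he hr]

/-- **The real chart of the level curve** attached to an adapted chart `e`: `z ↦ re (e z)` on
`Z ∩ e.source`, with inverse `r ↦ e.symm r` on `{r | ↑r ∈ e.target}`. [folklore] -/
def reChart {e : OpenPartialHomeomorph X ℂ} (he : e ∈ 𝒻.charts) : OpenPartialHomeomorph Z ℝ where
  toFun z := (e z).re
  invFun := 𝒻.reInv he
  source := {z | (z : X) ∈ e.source}
  target := {r | (r : ℂ) ∈ e.target}
  map_source' z hz := by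
    show (((e z).re : ℝ) : ℂ) ∈ e.target
    rw [← 𝒻.apply_eq_re he z.2 hz]
    exact e.map_source hz
  map_target' r hr := by
    have hr' : (r : ℂ) ∈ e.target := hr
    show (𝒻.reInv he r : X) ∈ e.source
    rw [𝒻.reInv_coe_of_mem he hr']
    exact e.map_target hr'
  left_inv' z hz := by
    have h1 : (((e z).re : ℝ) : ℂ) = e z := (𝒻.apply_eq_re he z.2 hz).symm
    have h2 : (((e z).re : ℝ) : ℂ) ∈ e.target := by rw [h1]; exact e.map_source hz
    show 𝒻.reInv he (e z).re = z
    rw [𝒻.reInv_of_mem he h2]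
    apply Subtype.ext
    show e.symm _ = _
    rw [h1, e.left_inv hz]
  right_inv' r hr := by
    have hr' : (r : ℂ) ∈ e.target := hr
    show (e (𝒻.reInv he r : X)).re = r
    rw [𝒻.reInv_coe_of_mem he hr', e.right_inv hr']; simp
  open_source := e.open_source.preimage continuous_subtype_val
  open_target := e.open_target.preimage Complex.continuous_ofReal
  continuousOn_toFun := Complex.continuous_re.comp_continuousOn
    (e.continuousOn.comp continuous_subtype_val.continuousOn fun z hz => hz)
  continuousOn_invFun := by
    rw [Topology.IsInducing.subtypeVal.continuousOn_iff]
    have h : ContinuousOn (fun r : ℝ => e.symm (r : ℂ)) {r : ℝ | (r : ℂ) ∈ e.target} :=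
      e.continuousOn_symm.comp Complex.continuous_ofReal.continuousOn fun r hr => hr
    refine h.congr fun r hr => ?_
    show (𝒻.reInv he r : X) = e.symm r
    exact 𝒻.reInv_coe_of_mem he hr

/-- The real chart as a function. [folklore] -/
@[simp] theorem reChart_apply {e : OpenPartialHomeomorph X ℂ} (he : e ∈ 𝒻.charts) (z : Z) :
    𝒻.reChart he z = (e z).re := rfl

/-- The source of the real chart. [folklore] -/
theorem reChart_source {e : OpenPartialHomeomorph X ℂ} (he : e ∈ 𝒻.charts) :
    (𝒻.reChart he).source = {z : Z | (z : X) ∈ e.source} := rfl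

/-- The target of the real chart. [folklore] -/
theorem reChart_target {e : OpenPartialHomeomorph X ℂ} (he : e ∈ 𝒻.charts) :
    (𝒻.reChart he).target = {r : ℝ | (r : ℂ) ∈ e.target} := rfl

/-- The inverse of the real chart on its target. [folklore] -/
theorem reChart_symm_apply_coe {e : OpenPartialHomeomorph X ℂ} (he : e ∈ 𝒻.charts) {r : ℝ}
    (hr : (r : ℂ) ∈ e.target) : ((𝒻.reChart he).symm r : X) = e.symm r :=
  𝒻.reInv_coe_of_mem he hr

/-- **Transition maps of the real charts are `C^∞`**: on its source, the transition
`(reChart e).symm ≫ reChart e'` is `r ↦ re (e' (e.symm r))`. [folklore] -/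
theorem contDiffOn_reChart_trans {e e' : OpenPartialHomeomorph X ℂ} (he : e ∈ 𝒻.charts)
    (he' : e' ∈ 𝒻.charts) :
    ContDiffOn ℝ ∞ ((𝒻.reChart he).symm.trans (𝒻.reChart he'))
      ((𝒻.reChart he).symm.trans (𝒻.reChart he')).source := by
  have hsrc : ((𝒻.reChart he).symm.trans (𝒻.reChart he')).source =
      {r : ℝ | (r : ℂ) ∈ e.target ∧ e.symm r ∈ e'.source} := by
    ext r
    rw [OpenPartialHomeomorph.trans_source, OpenPartialHomeomorph.symm_source, reChart_target]
    constructor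
    · rintro ⟨hr, hr'⟩
      refine ⟨hr, ?_⟩
      rw [mem_preimage, reChart_source, mem_setOf_eq, 𝒻.reChart_symm_apply_coe he hr] at hr'
      exact hr'
    · rintro ⟨hr, hr'⟩
      refine ⟨hr, ?_⟩
      rw [mem_preimage, reChart_source, mem_setOf_eq, 𝒻.reChart_symm_apply_coe he hr]
      exact hr'
  rw [hsrc]
  have hg : ContDiffOn ℝ ∞ (fun r : ℝ => (e' (e.symm (r : ℂ))).re)
      {r : ℝ | (r : ℂ) ∈ e.target ∧ e.symm r ∈ e'.source} := by
    have h1 : ContDiffOn ℝ ∞ (e' ∘ e.symm) (e.target ∩ e.symm ⁻¹' e'.source) :=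
      (𝒻.compat e he e' he').contDiffOn
    have h2 : ContDiffOn ℝ ∞ (fun r : ℝ => (e' ∘ e.symm) (r : ℂ))
        {r : ℝ | (r : ℂ) ∈ e.target ∧ e.symm r ∈ e'.source} :=
      h1.comp Complex.ofRealCLM.contDiff.contDiffOn fun r hr => ⟨hr.1, hr.2⟩
    exact Complex.reCLM.contDiff.comp_contDiffOn h2
  refine hg.congr fun r hr => ?_
  show (e' ((𝒻.reChart he).symm r : X)).re = (e' (e.symm (r : ℂ))).re
  rw [𝒻.reChart_symm_apply_coe he hr.1]

/-! ### The charted-space structure on the level curve -/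

/-- The linear isometry `ℝ ≃ ℝ¹`. [folklore] -/
def lineIso : ℝ ≃L[ℝ] EuclideanSpace ℝ (Fin 1) :=
  ((PiLp.continuousLinearEquiv 2 ℝ (fun _ : Fin 1 => ℝ)).trans
    (ContinuousLinearEquiv.funUnique (Fin 1) ℝ ℝ)).symm

omit [Nonempty Z] in
/-- A chosen adapted chart at each point of `Z`. [folklore] -/
def chartOf (z : Z) : OpenPartialHomeomorph X ℂ := (𝒻.covers z z.2).choose

omit [Nonempty Z] in
/-- The chosen chart is one of the family. [folklore] -/
theorem chartOf_mem (z : Z) : 𝒻.chartOf z ∈ 𝒻.charts := (𝒻.covers z z.2).choose_spec.1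

omit [Nonempty Z] in
/-- The point lies in the source of its chosen chart. [folklore] -/
theorem mem_chartOf_source (z : Z) : (z : X) ∈ (𝒻.chartOf z).source := (𝒻.covers z z.2).choose_spec.2

/-- The `ℝ¹`-valued chart of `Z` attached to an adapted chart. [folklore] -/
def lineChart {e : OpenPartialHomeomorph X ℂ} (he : e ∈ 𝒻.charts) :
    OpenPartialHomeomorph Z (EuclideanSpace ℝ (Fin 1)) :=
  (𝒻.reChart he).transHomeomorph lineIso.toHomeomorph

/-- **The level curve as a charted space modelled on `ℝ¹`**: the charts are the real charts of
the chosen adapted charts, read in `ℝ¹`. [folklore] -/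
@[reducible] def chartedSpace : ChartedSpace (EuclideanSpace ℝ (Fin 1)) Z where
  atlas := range fun z : Z => 𝒻.lineChart (𝒻.chartOf_mem z)
  chartAt z := 𝒻.lineChart (𝒻.chartOf_mem z)
  mem_chart_source z := 𝒻.mem_chartOf_source z
  chart_mem_atlas z := mem_range_self z

/-- Transition maps of two line charts are `C^∞` (conjugate the real transition by the linear
isometry `ℝ ≃ ℝ¹`), in the form consumed by `isManifold_of_contDiffOn`. [folklore] -/
theorem contDiffOn_lineChart_trans {e e' : OpenPartialHomeomorph X ℂ} (he : e ∈ 𝒻.charts)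
    (he' : e' ∈ 𝒻.charts) :
    ContDiffOn ℝ ∞ ((𝓡 1) ∘ ((𝒻.lineChart he).symm.trans (𝒻.lineChart he')) ∘ (𝓡 1).symm)
      ((𝓡 1).symm ⁻¹' ((𝒻.lineChart he).symm.trans (𝒻.lineChart he')).source ∩ range (𝓡 1)) := by
  simp only [modelWithCornersSelf_coe, modelWithCornersSelf_coe_symm, Function.id_comp,
    Function.comp_id, preimage_id_eq, id_eq, range_id, inter_univ]
  have key : ContDiffOn ℝ ∞ (lineIso ∘ ((𝒻.reChart he).symm.trans (𝒻.reChart he')) ∘ lineIso.symm)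
      (lineIso.symm ⁻¹' ((𝒻.reChart he).symm.trans (𝒻.reChart he')).source) :=
    lineIso.contDiff.comp_contDiffOn ((𝒻.contDiffOn_reChart_trans he he').comp
      lineIso.symm.contDiff.contDiffOn fun _ hv => hv)
  exact key

/-- **The level curve is a `C^∞` manifold of dimension `1`** (with the charted-space structure
`𝒻.chartedSpace`). [folklore] -/
theorem isManifold : @IsManifold ℝ _ _ _ _ _ _ (𝓡 1) ∞ Z _ 𝒻.chartedSpace := by
  letI := 𝒻.chartedSpace
  refine isManifold_of_contDiffOn (𝓡 1) ∞ Z ?_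
  rintro _ _ ⟨z, rfl⟩ ⟨z', rfl⟩
  exact 𝒻.contDiffOn_lineChart_trans (𝒻.chartOf_mem z) (𝒻.chartOf_mem z')

/-- Every line chart of the family (not only the chosen ones) belongs to the maximal `C^∞`
atlas of the level curve. [folklore] -/
theorem lineChart_mem_maximalAtlas {e : OpenPartialHomeomorph X ℂ} (he : e ∈ 𝒻.charts) :
    𝒻.lineChart he ∈ @IsManifold.maximalAtlas ℝ _ _ _ _ _ _ (𝓡 1) ∞ Z _ 𝒻.chartedSpace := by
  letI := 𝒻.chartedSpace
  haveI := 𝒻.isManifold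
  rw [IsManifold.maximalAtlas, mem_maximalAtlas_iff]
  rintro _ ⟨z, rfl⟩
  rw [contDiffGroupoid, mem_groupoid_of_pregroupoid, mem_groupoid_of_pregroupoid]
  refine ⟨⟨?_, ?_⟩, ?_, ?_⟩
  · exact 𝒻.contDiffOn_lineChart_trans he (𝒻.chartOf_mem z)
  · have h := 𝒻.contDiffOn_lineChart_trans (𝒻.chartOf_mem z) he
    rw [OpenPartialHomeomorph.trans_symm_eq_symm_trans_symm, OpenPartialHomeomorph.symm_symm]
    convert h using 2
    rw [OpenPartialHomeomorph.trans_target, OpenPartialHomeomorph.trans_source,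
      OpenPartialHomeomorph.symm_source, OpenPartialHomeomorph.symm_target]
    rfl
  · exact 𝒻.contDiffOn_lineChart_trans (𝒻.chartOf_mem z) he
  · have h := 𝒻.contDiffOn_lineChart_trans he (𝒻.chartOf_mem z)
    rw [OpenPartialHomeomorph.trans_symm_eq_symm_trans_symm, OpenPartialHomeomorph.symm_symm]
    convert h using 2
    rw [OpenPartialHomeomorph.trans_target, OpenPartialHomeomorph.trans_source,
      OpenPartialHomeomorph.symm_source, OpenPartialHomeomorph.symm_target]
    rfl

end AdaptedFamily

end SurfaceSmoothing

end Literature.Topology.FourManifolds
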